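import Mathlib
import Summits.AnomalousDissipation.AnomalousDissipation.Theses.DyadicWallCascade
import Summits.AnomalousDissipation.AnomalousDissipation.Theorems.DyadicWallCascadeDyadicRealisationFluxSignTools
import Summits.AnomalousDissipation.AnomalousDissipation.Theorems.DyadicWallCascadeDyadicRealisationFluxSignTools3
import Summits.AnomalousDissipation.AnomalousDissipation.Theorems.DyadicWallCascadeDyadicRealisationFluxSignTools4
import Summits.AnomalousDissipation.AnomalousDissipation.Theorems.DyadicWallCascadeDyadicRealisationZeroStressTools
import Summits.AnomalousDissipation.AnomalousDissipation.Theorems.DyadicWallCascadeDyadicRealisationZeroStressTools2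
import HarnessLib

/-!
# The blow-down of a viscous wall profile carries no Reynolds stress (stub `stub_zeroStress`)

Crux `DyadicRealisation` of route `DyadicWallCascade` (`Summits/AnomalousDissipation`), line
Sketch.  A bounded smooth mirror-symmetric force-free steady Navier–Stokes pair `(W, P)` on `ℝ³`
whose dyadic blow-downs converge uniformly on the band `1 ≤ X₂ ≤ 2` to a half-space hierarchy
`(V, Q, C, F)` has `∫_{[0,1]²} V₂V₀(q, 1) dq = ∫_{[0,1]²} V₂V₁(q, 1) dq = 0`.

Proof (tools files `…ZeroStressTools`, `…Tools2`, and the flux-sign engine `…FluxSignTools*`):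
test the horizontal momentum equation of the rescaled solutions `(2ᵐW(2ᵐ·), 4ᵐP(2ᵐ·))` with
`χ_R(Y₀)χ_R(Y₁)θ_b(Y₂) eᵢ` (`zeroStress_scale_ineq`): the Laplacian term is `O(2⁻ᵐ)`, the
horizontal transport and pressure terms are `O(R)`, and the two vertical edges of `θ_b` carry
the same stress flux by the mirror symmetry (`Wᵢ` even, `W₂` odd), whence
`|2∫χ_Rχ_Rρ_b W₂Wᵢ(2ᵐ·)| ≤ 2⁻ᵐA + O(R)`.  Let `m → ∞` (uniform convergence on the band,
`zeroStress_limit_abs`), average horizontally using the band periodicity of `V`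
(`fluxSign_integral_telescope`: the main term is exactly `4R²·J`) and let `R → ∞`: the cell
average `J = ∫κ(Y₀)κ(Y₁)ρ_b(Y₂) V₂Vᵢ` over the layer `1 < Y₂ < 1 + 1/b` vanishes for every
`b ≥ 1`, and the thin-layer limit `b → ∞` (`zeroStress_layer_limit`) gives the claim.
-/

open MeasureTheory Set Filter Topology Function

set_option linter.dupNamespace false

namespace Summit.AnomalousDissipation.AnomalousDissipation.Theorems

/-- **One horizontal component of the Reynolds stress of the blow-down vanishes.**  For a bounded
smooth mirror-symmetric force-free steady Navier–Stokes pair `(W, P)` on `ℝ³` whose dyadic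
blow-downs `W(2ᵐ·)` converge uniformly on the band `1 ≤ X₂ ≤ 2` to a bounded band-periodic
field `V`, smooth on the upper half-space, and a horizontal direction `i ≠ 2`:
`∫_{[0,1]²} V₂Vᵢ(q, 1) dq = 0` (see the module docstring). [folklore] -/
theorem zeroStress_component
    (W : EuclideanSpace ℝ (Fin 3) → EuclideanSpace ℝ (Fin 3)) (P : EuclideanSpace ℝ (Fin 3) → ℝ)
    (V : EuclideanSpace ℝ (Fin 3) → EuclideanSpace ℝ (Fin 3)) (C C' : ℝ) (i : Fin 3) (hi : i ≠ 2)
    (hVs : ContDiffOn ℝ ((⊤ : ℕ∞) : WithTop ℕ∞) V {X : EuclideanSpace ℝ (Fin 3) | 0 < X 2})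
    (hbdd : ∀ X : EuclideanSpace ℝ (Fin 3), 0 < X 2 → ‖V X‖ ≤ C)
    (hper : ∀ X : EuclideanSpace ℝ (Fin 3), 1 ≤ X 2 → X 2 ≤ 2 →
      V (X + EuclideanSpace.single 0 (1 : ℝ)) = V X ∧ V (X + EuclideanSpace.single 1 (1 : ℝ)) = V X)
    (hWs : ContDiff ℝ ((⊤ : ℕ∞) : WithTop ℕ∞) W) (hPs : ContDiff ℝ ((⊤ : ℕ∞) : WithTop ℕ∞) P)
    (hWb : ∀ X : EuclideanSpace ℝ (Fin 3), ‖W X‖ ≤ C' ∧ |P X| ≤ C')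
    (hmir : ∀ X : EuclideanSpace ℝ (Fin 3),
      W (X - (2 * X 2) • EuclideanSpace.single 2 (1 : ℝ)) =
          W X - (2 * (W X) 2) • EuclideanSpace.single 2 (1 : ℝ) ∧
        P (X - (2 * X 2) • EuclideanSpace.single 2 (1 : ℝ)) = P X)
    (hWdiv : ∀ X : EuclideanSpace ℝ (Fin 3),
      ∑ i : Fin 3, (fderiv ℝ W X (EuclideanSpace.single i (1 : ℝ))) i = 0)
    (hNS : ∀ X : EuclideanSpace ℝ (Fin 3), (fderiv ℝ W X) (W X) + gradient P X =
      ∑ i : Fin 3, fderiv ℝ (fun Y => fderiv ℝ W Y (EuclideanSpace.single i (1 : ℝ))) X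
        (EuclideanSpace.single i (1 : ℝ)))
    (hbd : ∀ ε : ℝ, 0 < ε → ∃ M : ℕ, ∀ m : ℕ, M ≤ m → ∀ X : EuclideanSpace ℝ (Fin 3),
      1 ≤ X 2 → X 2 ≤ 2 → ‖W ((2 : ℝ) ^ m • X) - V X‖ ≤ ε) :
    ∫ q in Set.Icc (0 : ℝ) 1 ×ˢ Set.Icc (0 : ℝ) 1,
      (V !₂[q.1, q.2, (1 : ℝ)]) 2 * (V !₂[q.1, q.2, (1 : ℝ)]) i = 0 := by
  -- ### the regularised stress density of the limit
  set π : EuclideanSpace ℝ (Fin 3) → EuclideanSpace ℝ (Fin 3) :=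
    fun Y => !₂[Y 0, Y 1, max (Y 2) 2⁻¹] with hπ
  have hπc : Continuous π := by rw [hπ]; fun_prop
  have hπ2 : ∀ Y, (π Y) 2 = max (Y 2) 2⁻¹ := fun Y => by simp [hπ]
  have hπH : ∀ Y, π Y ∈ {X : EuclideanSpace ℝ (Fin 3) | 0 < X 2} := fun Y => by
    rw [mem_setOf_eq, hπ2]; exact lt_max_of_lt_right (by norm_num)
  have hπid : ∀ Y : EuclideanSpace ℝ (Fin 3), 2⁻¹ ≤ Y 2 → π Y = Y := fun Y hY => by
    ext j; fin_cases j <;> simp [hπ, max_eq_left hY]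
  set Φ : EuclideanSpace ℝ (Fin 3) → ℝ := fun Y => (V (π Y)) 2 * (V (π Y)) i with hΦ
  have hVπ : Continuous fun Y => V (π Y) := hVs.continuousOn.comp_continuous hπc hπH
  have hΦc : Continuous Φ :=
    ((PiLp.continuous_apply 2 _ 2).comp hVπ).mul ((PiLp.continuous_apply 2 _ i).comp hVπ)
  have hΦeq : ∀ Y : EuclideanSpace ℝ (Fin 3), 2⁻¹ ≤ Y 2 → Φ Y = (V Y) 2 * (V Y) i :=
    fun Y hY => by simp only [hΦ]; rw [hπid Y hY]
  have he0 : ∀ Y : EuclideanSpace ℝ (Fin 3),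
      (Y + EuclideanSpace.single (0 : Fin 3) (1 : ℝ)) 2 = Y 2 := fun Y => by simp
  have he1 : ∀ Y : EuclideanSpace ℝ (Fin 3),
      (Y + EuclideanSpace.single (1 : Fin 3) (1 : ℝ)) 2 = Y 2 := fun Y => by simp
  have hΦper : ∀ Y : EuclideanSpace ℝ (Fin 3), 1 ≤ Y 2 → Y 2 ≤ 2 →
      Φ (Y + EuclideanSpace.single 0 (1 : ℝ)) = Φ Y ∧
        Φ (Y + EuclideanSpace.single 1 (1 : ℝ)) = Φ Y := by
    intro Y h1 h2
    have hY : 2⁻¹ ≤ Y 2 := by linarith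
    obtain ⟨pV0, pV1⟩ := hper Y h1 h2
    rw [hΦeq Y hY, hΦeq _ (by rw [he0]; exact hY), hΦeq _ (by rw [he1]; exact hY), pV0, pV1]
    exact ⟨rfl, rfl⟩
  -- ### the profiles
  obtain ⟨S1, κ, χ, ρf, θf, ⟨hS1c, hS1cs, hS1nn, -, hS1i⟩, ⟨hκc, hκcs, hκnn, hκ0, hκ2, hκ1⟩, hχ,
    hρθ⟩ := fluxSign_profiles
  -- ### reduction to the vanishing of the cell averages (thin-layer limit)
  have hpt2 : ∀ a c : ℝ, (!₂[a, c, (1 : ℝ)] : EuclideanSpace ℝ (Fin 3)) 2 = 1 := by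
    intro a c; simp
  suffices hJ : ∀ b : ℝ, 1 ≤ b →
      ∫ Y : EuclideanSpace ℝ (Fin 3), κ (Y 0) * κ (Y 1) * (ρf b (Y 2) * Φ Y) = 0 by
    have hgoal := zeroStress_layer_limit κ ρf Φ hκc hκnn hκ0 hκ2 hκ1
      (fun b hb => ⟨(hρθ b hb).1, (hρθ b hb).2.1, (hρθ b hb).2.2.1, (hρθ b hb).2.2.2.1⟩) hΦc
      hΦper hJ
    refine Eq.trans (setIntegral_congr_fun (measurableSet_Icc.prod measurableSet_Icc)
      fun q _ => ?_) hgoal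
    rw [hΦeq _ (by rw [hpt2]; norm_num)]
  intro b hb1
  obtain ⟨hρc, hρnn, hρsupp, -, hθs, hθcs, hθ01, -, hθd⟩ := hρθ b hb1
  have hρcs : HasCompactSupport (ρf b) :=
    HasCompactSupport.of_support_subset_isCompact (isCompact_Icc (a := (1 : ℝ)) (b := 2))
      fun s hs => ⟨(hρsupp s hs).1.le, by
        linarith [(hρsupp s hs).2, inv_le_one_of_one_le₀ hb1]⟩
  have hρr : ∃ r : ℝ, ∀ t, ρf b t ≠ 0 → |t| ≤ r :=
    ⟨2, fun t ht => abs_le.2 ⟨by linarith [(hρsupp t ht).1], by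
      linarith [(hρsupp t ht).2, inv_le_one_of_one_le₀ hb1]⟩⟩
  have hκint : Integrable κ := hκc.integrable_of_hasCompactSupport hκcs
  have hκi : ∫ t, κ t = 1 := by
    have := fluxSign_cell_average_one κ (fun _ => 1) hκc continuous_const hκ0 hκ2 hκ1
      (fun _ => rfl)
    simpa using this
  have hχi : ∀ R : ℕ, ∫ t, χ R t = 2 * R := fun R => by
    simp_rw [(hχ R).2.2.2.1]
    rw [fluxSign_integral_sum_translates κ R hκint, hκi, mul_one]
  set Cw : ℝ := C' ^ 2 + C' with hCw
  set Kθ : ℝ := ∫ s, θf b s with hKθ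
  have hC'0 : 0 ≤ C' := (norm_nonneg _).trans (hWb 0).1
  have hCw0 : 0 ≤ Cw := by rw [hCw]; positivity
  have hKθ0 : 0 ≤ Kθ := integral_nonneg fun s => (hθ01 s).1
  have hWc : Continuous W := hWs.continuous
  have huc : ∀ m : ℕ, Continuous fun Y : EuclideanSpace ℝ (Fin 3) =>
      (W ((2 : ℝ) ^ m • Y)) 2 * (W ((2 : ℝ) ^ m • Y)) i := by
    intro m
    have hw : Continuous fun Y : EuclideanSpace ℝ (Fin 3) => W ((2 : ℝ) ^ m • Y) :=
      hWc.comp (continuous_const_smul _)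
    exact ((PiLp.continuous_apply 2 _ 2).comp hw).mul ((PiLp.continuous_apply 2 _ i).comp hw)
  -- ### the cell average `J` of the limiting stress density is `O(1/R)` for every `R`
  set J : ℝ := ∫ Y : EuclideanSpace ℝ (Fin 3), κ (Y 0) * κ (Y 1) * (ρf b (Y 2) * Φ Y) with hJ
  have hJle : ∀ R : ℕ, |2 * ((2 * (R : ℝ)) ^ 2 * J)| ≤ 4 * Cw * ((2 * R) * Kθ) := by
    intro R
    obtain ⟨hχs, hχcs, hχ01, hχsum, hχd⟩ := hχ R
    have hχr := fluxSign_exists_abs_le_of_hasCompactSupport hχcs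
    obtain ⟨A, hA⟩ := zeroStress_scale_ineq W P C' S1 (χ R) (ρf b) (θf b) R i hi hWs hPs hWdiv
      hNS hWb hmir hS1c hS1cs hS1nn hS1i hχs hχcs hχ01 hχd hρc hρcs hθs hθcs hθ01 hθd
    -- the blow-down limit
    have hg : Integrable (fun Y : EuclideanSpace ℝ (Fin 3) =>
        χ R (Y 0) * χ R (Y 1) * ρf b (Y 2)) := by
      simpa using fluxSign_integrable_prod3 (χ R) (χ R) (ρf b) (fun _ => (1 : ℝ))
        hχs.continuous hχs.continuous hρc continuous_const hχr hχr hρr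
    have hgu : ∀ m : ℕ, Integrable (fun Y : EuclideanSpace ℝ (Fin 3) =>
        χ R (Y 0) * χ R (Y 1) * ρf b (Y 2) *
          ((W ((2 : ℝ) ^ m • Y)) 2 * (W ((2 : ℝ) ^ m • Y)) i)) :=
      fun m => fluxSign_integrable_prod3 (χ R) (χ R) (ρf b) _ hχs.continuous hχs.continuous
        hρc (huc m) hχr hχr hρr
    have hgΦ : Integrable (fun Y : EuclideanSpace ℝ (Fin 3) =>
        χ R (Y 0) * χ R (Y 1) * ρf b (Y 2) * Φ Y) :=
      fluxSign_integrable_prod3 (χ R) (χ R) (ρf b) Φ hχs.continuous hχs.continuous hρc hΦc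
        hχr hχr hρr
    have hconv : ∀ ε : ℝ, 0 < ε → ∃ M : ℕ, ∀ m : ℕ, M ≤ m → ∀ Y : EuclideanSpace ℝ (Fin 3),
        χ R (Y 0) * χ R (Y 1) * ρf b (Y 2) ≠ 0 →
          |(W ((2 : ℝ) ^ m • Y)) 2 * (W ((2 : ℝ) ^ m • Y)) i - Φ Y| ≤ ε := by
      intro ε hε
      set L : ℝ := |C'| + |C| with hL
      have hL0 : 0 ≤ L := by rw [hL]; positivity
      obtain ⟨M, hM⟩ := hbd (ε / (L + 1)) (by positivity)
      refine ⟨M, fun m hm Y hY => ?_⟩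
      have hρ0 : ρf b (Y 2) ≠ 0 := fun h0 => hY (by rw [h0, mul_zero])
      have h1 : 1 ≤ Y 2 := (hρsupp _ hρ0).1.le
      have h2 : Y 2 ≤ 2 := by linarith [(hρsupp _ hρ0).2, inv_le_one_of_one_le₀ hb1]
      have hWV := hM m hm Y h1 h2
      rw [hΦeq Y (by linarith)]
      have hV := hbdd Y (by linarith)
      have key := zeroStress_density_lipschitz (W ((2 : ℝ) ^ m • Y)) (V Y) C C' i (hWb _).1 hV
      refine key.trans ?_
      rw [← hL]
      calc L * ‖W ((2 : ℝ) ^ m • Y) - V Y‖ ≤ L * (ε / (L + 1)) := by gcongr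
        _ ≤ ε := by
            rw [mul_div_assoc', div_le_iff₀ (by positivity)]
            nlinarith
    have hineq : ∀ m : ℕ, |2 * ∫ Y : EuclideanSpace ℝ (Fin 3), χ R (Y 0) * χ R (Y 1) * ρf b (Y 2) *
        ((W ((2 : ℝ) ^ m • Y)) 2 * (W ((2 : ℝ) ^ m • Y)) i)| ≤
        ((2 : ℝ) ^ m)⁻¹ * A + 4 * (C' ^ 2 + C') * ((∫ t, χ R t) * ∫ s, θf b s) :=
      fun m => hA ((2 : ℝ) ^ m) (by positivity)
    have hlim := zeroStress_limit_abs (fun Y => χ R (Y 0) * χ R (Y 1) * ρf b (Y 2)) Φ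
      (fun m Y => (W ((2 : ℝ) ^ m • Y)) 2 * (W ((2 : ℝ) ^ m • Y)) i)
      A (4 * (C' ^ 2 + C') * ((∫ t, χ R t) * ∫ s, θf b s)) hg hgu hgΦ hconv hineq
    -- horizontal averaging
    have htel := fluxSign_integral_telescope κ (fun Y => ρf b (Y 2) * Φ Y) R hκc hκcs
      ((hρc.comp (PiLp.continuous_apply 2 _ 2)).mul hΦc)
      ⟨2, fun Y hY => by
        have hρ0 : ρf b (Y 2) ≠ 0 := fun h0 => hY (by rw [h0, zero_mul])
        exact abs_le.2 ⟨by linarith [(hρsupp _ hρ0).1], by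
          linarith [(hρsupp _ hρ0).2, inv_le_one_of_one_le₀ hb1]⟩⟩
      (fun Y => by
        simp only [he0]
        by_cases h0 : ρf b (Y 2) = 0
        · rw [h0, zero_mul, zero_mul]
        · rw [(hΦper Y (hρsupp _ h0).1.le (by
            linarith [(hρsupp _ h0).2, inv_le_one_of_one_le₀ hb1])).1])
      (fun Y => by
        simp only [he1]
        by_cases h0 : ρf b (Y 2) = 0
        · rw [h0, zero_mul, zero_mul]
        · rw [(hΦper Y (hρsupp _ h0).1.le (by
            linarith [(hρsupp _ h0).2, inv_le_one_of_one_le₀ hb1])).2])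
    have hmain : ∫ Y : EuclideanSpace ℝ (Fin 3), χ R (Y 0) * χ R (Y 1) * ρf b (Y 2) * Φ Y =
        (2 * (R : ℝ)) ^ 2 * J := by
      rw [hJ, ← htel]
      refine integral_congr_ae (Eventually.of_forall fun Y => ?_)
      simp only
      rw [hχsum, hχsum]
      ring
    simp only at hlim
    rw [hmain, hχi R, ← hCw, ← hKθ] at hlim
    exact hlim
  -- ### `R → ∞`
  by_contra hJ0
  have hJpos : 0 < |J| := abs_pos.2 hJ0
  obtain ⟨R, hR⟩ := exists_nat_gt (Cw * Kθ / |J|)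
  have h1 := hJle (R + 1)
  push_cast at h1
  have hR1 : Cw * Kθ / |J| < (R : ℝ) + 1 := hR.trans (by linarith)
  rw [div_lt_iff₀ hJpos] at hR1
  rw [abs_mul, abs_mul, abs_of_pos (by positivity : (0 : ℝ) < 2),
    abs_of_nonneg (by positivity : (0 : ℝ) ≤ (2 * ((R : ℝ) + 1)) ^ 2)] at h1
  have hR0 : (0 : ℝ) ≤ R := Nat.cast_nonneg R
  nlinarith [mul_nonneg hCw0 hKθ0, mul_nonneg hR0 hJpos.le]

/-- **The blow-down of a viscous wall profile carries no Reynolds stress.**  For a bounded smooth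
mirror-symmetric force-free steady Navier–Stokes pair `(W, P)` on `ℝ³` (unit viscosity) whose
dyadic blow-downs converge uniformly on the band `1 ≤ X₂ ≤ 2` to a half-space hierarchy
`(V, Q, C, F)` (bounded, band-periodic), the horizontal averages of the Reynolds stresses
`V₂V₀`, `V₂V₁` over the unit square of the plane `X₂ = 1` vanish.  (Tested horizontal momentum
identity at every dyadic scale, blow-down limit, horizontal averaging, thin-layer limit; see the
module docstring.) [folklore] -/
theorem stub_zeroStress : ∀ (W : EuclideanSpace ℝ (Fin 3) → EuclideanSpace ℝ (Fin 3)) (P :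
    EuclideanSpace ℝ (Fin 3) → ℝ) (V : EuclideanSpace ℝ (Fin 3) → EuclideanSpace ℝ (Fin 3)) (Q :
    EuclideanSpace ℝ (Fin 3) → ℝ) (C F C' : ℝ), (ContDiffOn ℝ ((⊤ : ℕ∞) : WithTop ℕ∞) V {X :
    EuclideanSpace ℝ (Fin 3) | 0 < X 2} ∧ ContDiffOn ℝ ((⊤ : ℕ∞) : WithTop ℕ∞) Q {X :
    EuclideanSpace ℝ (Fin 3) | 0 < X 2} ∧ (∀ X : EuclideanSpace ℝ (Fin 3), 0 < X 2 → ‖V X‖ ≤ C ∧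
    |Q X| ≤ C) ∧ (∀ X : EuclideanSpace ℝ (Fin 3), 0 < X 2 → ∑ i : Fin 3, (fderiv ℝ V X
    (EuclideanSpace.single i (1 : ℝ))) i = 0) ∧ (∀ X : EuclideanSpace ℝ (Fin 3), 0 < X 2 →
    (fderiv ℝ V X) (V X) + gradient Q X = 0) ∧ (∀ X : EuclideanSpace ℝ (Fin 3), 0 < X 2 → V ((2
    : ℝ) • X) = V X ∧ Q ((2 : ℝ) • X) = Q X) ∧ (∀ X : EuclideanSpace ℝ (Fin 3), 1 ≤ X 2 → X 2 ≤
    2 → V (X + EuclideanSpace.single 0 (1 : ℝ)) = V X ∧ V (X + EuclideanSpace.single 1 (1 : ℝ))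
    = V X ∧ Q (X + EuclideanSpace.single 0 (1 : ℝ)) = Q X ∧ Q (X + EuclideanSpace.single 1 (1 :
    ℝ)) = Q X) ∧ (∫ q in Set.Icc (0 : ℝ) 1 ×ˢ Set.Icc (0 : ℝ) 1, (V !₂[q.1, q.2, (1 : ℝ)]) 2 =
    0) ∧ F ≠ 0 ∧ (∫ q in Set.Icc (0 : ℝ) 1 ×ˢ Set.Icc (0 : ℝ) 1, (V !₂[q.1, q.2, (1 : ℝ)]) 2 *
    (‖V !₂[q.1, q.2, (1 : ℝ)]‖ ^ 2 / 2 + Q !₂[q.1, q.2, (1 : ℝ)]) = F)) ∧ ContDiff ℝ ((⊤ : ℕ∞)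
    : WithTop ℕ∞) W ∧ ContDiff ℝ ((⊤ : ℕ∞) : WithTop ℕ∞) P ∧ (∀ X : EuclideanSpace ℝ (Fin 3),
    ‖W X‖ ≤ C' ∧ |P X| ≤ C') ∧ (∀ X : EuclideanSpace ℝ (Fin 3), W (X - (2 * X 2) •
    EuclideanSpace.single 2 (1 : ℝ)) = W X - (2 * (W X) 2) • EuclideanSpace.single 2 (1 : ℝ) ∧
    P (X - (2 * X 2) • EuclideanSpace.single 2 (1 : ℝ)) = P X) ∧ (∀ X : EuclideanSpace ℝ (Fin
    3), ∑ i : Fin 3, (fderiv ℝ W X (EuclideanSpace.single i (1 : ℝ))) i = 0) ∧ (∀ X :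
    EuclideanSpace ℝ (Fin 3), (fderiv ℝ W X) (W X) + gradient P X = ∑ i : Fin 3, fderiv ℝ (fun
    Y => fderiv ℝ W Y (EuclideanSpace.single i (1 : ℝ))) X (EuclideanSpace.single i (1 : ℝ))) ∧
    (∀ ε : ℝ, 0 < ε → ∃ M : ℕ, ∀ m : ℕ, M ≤ m → ∀ X : EuclideanSpace ℝ (Fin 3), 1 ≤ X 2 → X 2
    ≤ 2 → ‖W ((2 : ℝ) ^ m • X) - V X‖ ≤ ε ∧ |P ((2 : ℝ) ^ m • X) - Q X| ≤ ε) → (∫ q in Set.Icc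
    (0 : ℝ) 1 ×ˢ Set.Icc (0 : ℝ) 1, (V !₂[q.1, q.2, (1 : ℝ)]) 2 * (V !₂[q.1, q.2, (1 : ℝ)]) 0 =
    0) ∧ (∫ q in Set.Icc (0 : ℝ) 1 ×ˢ Set.Icc (0 : ℝ) 1, (V !₂[q.1, q.2, (1 : ℝ)]) 2 * (V
    !₂[q.1, q.2, (1 : ℝ)]) 1 = 0) := by
  intro W P V Q C F C' h
  obtain ⟨⟨hVs, -, hbdd, -, -, -, hper, -, -, -⟩, hWs, hPs, hWb, hmir, hWdiv, hNS, hbd⟩ := h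
  have hbdd' : ∀ X : EuclideanSpace ℝ (Fin 3), 0 < X 2 → ‖V X‖ ≤ C := fun X hX => (hbdd X hX).1
  have hper' : ∀ X : EuclideanSpace ℝ (Fin 3), 1 ≤ X 2 → X 2 ≤ 2 →
      V (X + EuclideanSpace.single 0 (1 : ℝ)) = V X ∧ V (X + EuclideanSpace.single 1 (1 : ℝ)) = V X :=
    fun X h1 h2 => ⟨(hper X h1 h2).1, (hper X h1 h2).2.1⟩
  have hbd' : ∀ ε : ℝ, 0 < ε → ∃ M : ℕ, ∀ m : ℕ, M ≤ m → ∀ X : EuclideanSpace ℝ (Fin 3),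
      1 ≤ X 2 → X 2 ≤ 2 → ‖W ((2 : ℝ) ^ m • X) - V X‖ ≤ ε := by
    intro ε hε
    obtain ⟨M, hM⟩ := hbd ε hε
    exact ⟨M, fun m hm X h1 h2 => (hM m hm X h1 h2).1⟩
  exact ⟨zeroStress_component W P V C C' 0 (by decide) hVs hbdd' hper' hWs hPs hWb hmir hWdiv hNS
      hbd',
    zeroStress_component W P V C C' 1 (by decide) hVs hbdd' hper' hWs hPs hWb hmir hWdiv hNS hbd'⟩

end Summit.AnomalousDissipation.AnomalousDissipation.Theorems
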